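import Literature.MathematicalPhysics.QuantumFieldTheory.O2ChargeTwoEvenTermwise
import HarnessLib

/-!
# O(2) scan, the charged `2 × 2` sector `1`: domination, alignment, the rank-one coefficient structure and the termwise rule

The charge-`1` condition of the O(2) three-scalar scan (`O2ScanObligations.Pos1`):
`α(V⃗_{1,Δ,ℓ}[(−1)^ℓ][g]) ⪰ 0`, a `2 × 2` matrix in the basis `(x, y) = (λ_{φs𝒪}, λ_{tφ𝒪})`, built from SIX
block families (`O2ThreeScalarCrossing.quad1_eq`, tree rows `6, 7, 9, 11, 13, 17, 18, 19, 20, 21`):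
`y²`: `2εF∓_{(Δφ+Δt)/2}[g^{d,d}]` (`tφtφ`, `d = Δ_t − Δ_φ`, SIGN-INDEFINITE block) and `2F∓_{Δt}[g^{−d,d}]`
(`φttφ`); `x²`: `2εF⁻_{(Δφ+Δs)/2}[g^{dₛ,dₛ}]` (`φsφs`, `dₛ = Δ_φ − Δ_s`, SIGN-INDEFINITE) and `2F⁻_{Δφ}`,
`−2F⁺_{Δφ}` of `g^{−dₛ,dₛ}` (`sφφs`); `xy`: `W¹ = 2F⁻_{(Δφ+Δs)/2}[g^{dₛ,−d}]` (`φsφt`) and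
`εW² = 2εF∓_{Δφ}[g^{−dₛ,−d}]` (`sφφt`).  Four inputs give a TERMWISE test whose per-term condition involves
KERNEL VALUES ONLY (no Pochhammer ratios):

* Cauchy–Schwarz domination of both sign-indefinite DIAGONAL rows (`|ε| ≤ 1`;
  `O2ChargedSectorsTermwise.abs_nodeEval_crossF_gmm_le`), as in `O2ChargeTwoEvenTermwise`;
* ALIGNMENT of `W¹` by block conjugation (tree `BlockConjugationSymmetry.conjBlock`,
  `IsConformalBlock3D.conj`; `O2ChargeTwoEvenTermwise.nodeEval_crossF_conjBlock`):
  `W¹[G_{φsφt}] = W¹♮[𝒞_{α}G_{φsφt}]`, `α = −(d+dₛ)/2`, where the conjugated block is the typed `g^{−dₛ,d}`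
  with coefficient family `A_{n,j}(dₛ/2, d/2) = A_{n,j}(0,0)·ρₛρₜ` (`w1Form1_eq_w1Form1A`, `conj_φsφt`);
* ABSORPTION of the inherently misaligned `W²` (block `g^{−dₛ,−d}`, family `A(dₛ/2,−d/2)`) into the two
  diagonal budgets by the block-level AM–GM bound
  `|g^{−dₛ,−d}(x,y)| ≤ (θ·g^{−dₛ,dₛ}(x,y) + θ⁻¹·v^{d}·g^{−d,d}(x,y))/2` (`abs_sφφt_le`: termwise
  `T_q(dₛ/2,−d/2)² = T_q(dₛ/2,dₛ/2)·T_q(−d/2,−d/2)`, `BlockZSeriesABGeneral`, the second partner being the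
  conjugated block `𝒞_{d}G_{φttφ} = g^{d,−d}`), with `θ = κ|x|/|y|` node by node:
  `x·y·ε·W²[G_{sφφt}] ≥ −(κ·x²·T(b,−b;Δ_φ)[G_{sφφs}] + κ⁻¹·y²·T(b,−b;Δ_t)[G_{φttφ}])`, `b = |w²⁰|+|w²¹|`,
  `κ > 0` a free constant of the certificate (`xy_w2_lower`).  Hence
  `(x y) α(V⃗_1) (x;y) ≥ 𝔇₁(x,y) := x²·𝔇₁ˣ[G_{sφφs}] + y²·𝔇₁ʸ[G_{φttφ}] + xy·W¹[G_{φsφt}]`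
  (`dom1Form_le_sector1Form`) with `𝔇₁ˣ = T(cˣ − κb, dˣ + κb; Δ_φ)`, `𝔇₁ʸ = T(cʸ − κ⁻¹b, dʸ + κ⁻¹b; Δ_t)`,
  `cʸ = 2(w⁹+w¹¹) − 2(|w⁶|+|w⁷|)`, `dʸ = 2(w⁹−w¹¹) + 2(|w⁶|+|w⁷|)`, `cˣ = 2(w¹⁷−w¹⁸) − 2|w¹³|`,
  `dˣ = 2(w¹⁷+w¹⁸) + 2|w¹³|` (tree row indices);
* the rank-one structure `A_{n,j}(a,b) = A_{n,j}(0,0)ρ(a)ρ(b)` (`DoPochHalfFactor`): the three remaining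
  coefficient families are `A(0,0)·{ρₛ², ρₜ², ρₛρₜ}`, `ρₛ = ρ(dₛ/2)`, `ρₜ = ρ(d/2)` (`coeffs1_eq`), whence ONE
  series `𝔇₁(x,y) = Σ_{(n,j)} (A_{n,j}(0,0)/λ_ℓ) 𝔗_{n,j}(x,y)` (`hasSum_dom1Form`) with the TERM FORM
  `𝔗 = x²ρₛ²𝔇ˣ_q + y²ρₜ²𝔇ʸ_q + xy·ρₛρₜ·W¹♮_q = (ρₛx, ρₜy) M_q (ρₛx, ρₜy)ᵀ`,
  `M_q = [[𝔇ˣ_q, W¹♮_q/2], [W¹♮_q/2, 𝔇ʸ_q]]` (`dom1TermForm`): the per-term client test is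
  `𝔇ˣ_q ≥ 0, 𝔇ʸ_q ≥ 0, (W¹♮_q)² ≤ 4𝔇ˣ_q𝔇ʸ_q` (`dom1TermForm_nonneg_of_test`) — kernel values at
  `𝒫_{Δ+n,j}` only, uniformly in the external dimensions.

Contents: §1 the sector form `sector1Form`, dictionary `sector1Form_eq`, blocks of a genuine family, the
alignment of `W¹`; §2 budgets, the AM–GM absorption of `W²`, the dominating evaluations and
`dom1Form ≤ sector1Form`; §3 term form, series, the termwise rules `pos1_of_dom_termwise` /
`pos1_of_dom_forall` (regular point above the bound, `Δ ≠ 1` if `ℓ = 0`); §4 NON-REGULAR points by right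
limits (`pos1_of_eventually_right`).

R-07.5 PLANNING for the O(2) client path; no numerics.  HONEST SCOPE: a one-sided SUFFICIENT condition
(three rows replaced by Cauchy–Schwarz / AM–GM budgets; termwise PSD is stronger than PSD of the sum; the
constant `κ` trades the `x²` budget against the `y²` budget and is chosen by the certificate);
`(Δ, ℓ) = (1, 0)` is outside the estimate and is reached by no rule of this file.  With this file every
sector family of `O2Obligations` (`0±`, `4`, `3`, `2±`, `1`) has a typed termwise rule at regular points and a
right-limit rule elsewhere; finite-certificate READER rules (heads / cells in `Δ`) for the charged `2 × 2`
sectors are separate files.  DECLARATIONS: definitions `yForm1`, `xForm1`, `w1Form1`, `w2Form1`, `wForm1`,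
`sector1Form`, `w1Form1A`, `bWeight1`, `bEval1`, `cWeightY1`, `dWeightY1`, `domY1Eval`, `domY1Term`,
`cWeightX1`, `dWeightX1`, `domX1Eval`, `domX1Term`, `dom1Form`, `rhoS1`, `rhoT1`, `dom1TermForm`.

References: Chester–Landry–Liu–Poland–Simmons-Duffin–Su–Vichi, JHEP 06 (2020) 142, §2.1, §3.1, App.
«Crossing vectors» (`ChesterEtAl2020`); Kos–Poland–Simmons-Duffin, JHEP 11 (2014) 109, §3.1 eq. (3.8),
§3.3 eq. (3.16), §4 eqs. (4.2)–(4.3) (`KosPolandSimmonsduffin2014`); Pappadopulo–Rychkov–Espin–Rattazzi,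
Phys. Rev. D 86 (2012) 105043, §5 (`PappadopuloRychkovEspinRattazzi2012`); Dolan–Osborn, Nucl. Phys.
B 678 (2004) 491, §3 eqs. (3.10)–(3.11) (`DolanOsborn2004`); Dolan–Osborn, arXiv:1108.6194, §2
eqs. (2.43)–(2.44) (`DolanOsborn2011`); Hogervorst–Rychkov, Phys. Rev. D 87 (2013) 106004, §3
eqs. (3.6)–(3.9) (`HogervorstRychkov2013`).
-/

namespace Literature.MathematicalPhysics.QuantumFieldTheory.O2ChargeOneTermwise

open Finset Set Matrix Filter Topology
open Literature.MathematicalPhysics.QuantumFieldTheory.O2ThreeScalarCrossing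
open Literature.MathematicalPhysics.QuantumFieldTheory.O2ThreeScalarSystem
open Literature.MathematicalPhysics.QuantumFieldTheory.O2OPEScanBridge
open Literature.MathematicalPhysics.QuantumFieldTheory.O2ScanObligations
open Literature.MathematicalPhysics.QuantumFieldTheory.O2NeutralSectorsTermwise
open Literature.MathematicalPhysics.QuantumFieldTheory.O2ChargedSectorsTermwise
open Literature.MathematicalPhysics.QuantumFieldTheory.O2ChargeTwoEvenTermwise (binForm_nonneg
  crossF_conjBlock nodeEval_crossF_conjBlock)
open ConformalBootstrap3D (IsConformalBlock3D IsConformalBlock3DAbove IsRegularPoint3D unitarityBound3D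
  accidentalDegeneracy3D crossF pointFunctional pointFunctional_apply zMono legendreLam legendreLam_pos
  InDescendantRange hrCoeff hrCoeffAB hrCoeff_nonneg hrCoeff_eq_zero_of_not_inDescendantRange
  doPochFactor doPochFactor_zero_zero_pos doPochHalf doPochRatio doPochRatio_zero
  doPochHalf_zero_ne_zero hrCoeffAB_eq_hrCoeff_mul_doPochRatio
  hasSum_pointFunctional_crossF_hrZAB hasSum_pointFunctional_crossF_hrZAB_general
  tendsto_pointFunctional_crossF twoWeightEval conjBlock hrZTermAB hrZTermAB_sq_eq_self_mul_self
  hrZTermAB_self_nonneg abs_le_am_of_hasSum_sq_eq_mul)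

/-! ### §1 The charge-`1` sector form at the `z`-level and the dictionary -/

/-- The `tφ`–`tφ` entry of `V⃗_1`: `Y_ε[G] = 2εΦ₆[F⁻_{(Δφ+Δt)/2}G_{tφtφ}] + 2εΦ₇[F⁺G_{tφtφ}] + 2Φ₉[F⁻_{Δt}G_{φttφ}]
+ 2Φ₁₁[F⁺_{Δt}G_{φttφ}]` (tree rows `6, 7, 9, 11`). [cite: ChesterEtAl2020, App. «Crossing vectors» (`V⃗_{1,Δ,ℓ}`)] -/
noncomputable def yForm1 (F : ScanFunctional) (D : Dims) (ε : ℝ) (G : Label → ℝ → ℝ → ℝ) : ℝ :=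
  2 * ε * nodeEval F 6 (crossF (D.expo .tφtφ) (-1) (G .tφtφ)) +
        2 * ε * nodeEval F 7 (crossF (D.expo .tφtφ) 1 (G .tφtφ)) +
      2 * nodeEval F 9 (crossF (D.expo .φttφ) (-1) (G .φttφ)) +
    2 * nodeEval F 11 (crossF (D.expo .φttφ) 1 (G .φttφ))

/-- The `φs`–`φs` entry of `V⃗_1`: `X_ε[G] = 2εΦ₁₃[F⁻_{(Δφ+Δs)/2}G_{φsφs}] + 2Φ₁₇[F⁻_{Δφ}G_{sφφs}] − 2Φ₁₈[F⁺_{Δφ}G_{sφφs}]`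
(tree rows `13, 17, 18`). [cite: ChesterEtAl2020, App. «Crossing vectors» (`V⃗_{1,Δ,ℓ}`)] -/
noncomputable def xForm1 (F : ScanFunctional) (D : Dims) (ε : ℝ) (G : Label → ℝ → ℝ → ℝ) : ℝ :=
  2 * ε * nodeEval F 13 (crossF (D.expo .φsφs) (-1) (G .φsφs)) +
      2 * nodeEval F 17 (crossF (D.expo .sφφs) (-1) (G .sφφs)) -
    2 * nodeEval F 18 (crossF (D.expo .sφφs) 1 (G .sφφs))

/-- The `φsφt` part of the off-diagonal entry (doubled): `W¹[H] = 2Φ₁₉[F⁻_{(Δφ+Δs)/2}H]` (tree row `19`).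
[cite: ChesterEtAl2020, App. «Crossing vectors» (`V⃗_{1,Δ,ℓ}`)] -/
noncomputable def w1Form1 (F : ScanFunctional) (D : Dims) (H : ℝ → ℝ → ℝ) : ℝ :=
  2 * nodeEval F 19 (crossF (D.expo .φsφt) (-1) H)

/-- The `sφφt` part of the off-diagonal entry (doubled, without its factor `ε`):
`W²[H] = 2Φ₂₀[F⁻_{Δφ}H] + 2Φ₂₁[F⁺_{Δφ}H]` (tree rows `20, 21`). [cite: ChesterEtAl2020, App. «Crossing vectors» (`V⃗_{1,Δ,ℓ}`)] -/
noncomputable def w2Form1 (F : ScanFunctional) (D : Dims) (H : ℝ → ℝ → ℝ) : ℝ :=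
  2 * nodeEval F 20 (crossF (D.expo .sφφt) (-1) H) + 2 * nodeEval F 21 (crossF (D.expo .sφφt) 1 H)

/-- The off-diagonal entry of `V⃗_1` (doubled): `W_ε[G] = W¹[G_{φsφt}] + ε W²[G_{sφφt}]`.
[cite: ChesterEtAl2020, App. «Crossing vectors» (`V⃗_{1,Δ,ℓ}`)] -/
noncomputable def wForm1 (F : ScanFunctional) (D : Dims) (ε : ℝ) (G : Label → ℝ → ℝ → ℝ) : ℝ :=
  w1Form1 F D (G .φsφt) + ε * w2Form1 F D (G .sφφt)

/-- **The charge-`1` sector form** of a scan functional on a family `G` of `z`-coordinate functions, basis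
`(x, y) = (λ_{φs𝒪}, λ_{tφ𝒪})`: `x²·X_ε[G] + y²·Y_ε[G] + xy·W_ε[G]`. [cite: ChesterEtAl2020, App. «Crossing vectors» (`V⃗_{1,Δ,ℓ}`)] -/
noncomputable def sector1Form (F : ScanFunctional) (D : Dims) (ε : ℝ) (G : Label → ℝ → ℝ → ℝ) (x y : ℝ) : ℝ :=
  x ^ 2 * xForm1 F D ε G + y ^ 2 * yForm1 F D ε G + x * y * wForm1 F D ε G

/-- **Dictionary, sector `1`**: `(x y) α(V⃗_1[ε][g]) (x;y)` of a scan functional is the charge-`1` sector form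
of the `z`-coordinate blocks. Bookkeeping over the printed `V⃗_1`.
[cite: ChesterEtAl2020, App. «Crossing vectors» (`V⃗_{1,Δ,ℓ}`), §3.1 (functional conditions)] -/
theorem sector1Form_eq (F : ScanFunctional) (D : Dims) (ε : ℝ) (g : Label → ℝ → ℝ → ℝ) (x y : ℝ) :
    ![x, y] ⬝ᵥ (alphaMat F.toFunctional (V1 D ε g) *ᵥ ![x, y]) =
      sector1Form F D ε (fun L => pullbackZ (g L)) x y := by
  rw [alphaMat_quadForm, show quadVec ![x, y] (V1 D ε g) = quad1 D x y ε g from rfl,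
    ScanFunctional.toFunctional, pointFunctional₂₂_apply]
  have hnode : ∀ m : Fin F.M, ∑ r, F.w m r * quad1 D x y ε g (F.u m) (F.v m) r =
      x ^ 2 * (2 * ε * (F.w m 13 * crossF (D.expo .φsφs) (-1) (pullbackZ (g .φsφs)) (F.z m) (F.zb m)) +
            2 * (F.w m 17 * crossF (D.expo .sφφs) (-1) (pullbackZ (g .sφφs)) (F.z m) (F.zb m)) -
          2 * (F.w m 18 * crossF (D.expo .sφφs) 1 (pullbackZ (g .sφφs)) (F.z m) (F.zb m))) +
        y ^ 2 * (2 * ε * (F.w m 6 * crossF (D.expo .tφtφ) (-1) (pullbackZ (g .tφtφ)) (F.z m) (F.zb m)) +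
              2 * ε * (F.w m 7 * crossF (D.expo .tφtφ) 1 (pullbackZ (g .tφtφ)) (F.z m) (F.zb m)) +
            2 * (F.w m 9 * crossF (D.expo .φttφ) (-1) (pullbackZ (g .φttφ)) (F.z m) (F.zb m)) +
          2 * (F.w m 11 * crossF (D.expo .φttφ) 1 (pullbackZ (g .φttφ)) (F.z m) (F.zb m))) +
        x * y * (2 * (F.w m 19 * crossF (D.expo .φsφt) (-1) (pullbackZ (g .φsφt)) (F.z m) (F.zb m)) +
          ε * (2 * (F.w m 20 * crossF (D.expo .sφφt) (-1) (pullbackZ (g .sφφt)) (F.z m) (F.zb m)) +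
            2 * (F.w m 21 * crossF (D.expo .sφφt) 1 (pullbackZ (g .sφφt)) (F.z m) (F.zb m)))) := by
    intro m
    rw [sum_univ_fin22, quad1_eq]
    simp only [ScanFunctional.u, ScanFunctional.v, Fminus_pullbackZ, Fplus_pullbackZ]
    simp
    ring
  rw [Finset.sum_congr rfl fun m _ => hnode m]
  simp only [sector1Form, xForm1, yForm1, wForm1, w1Form1, w2Form1, nodeEval_apply, Finset.mul_sum,
    ← Finset.sum_add_distrib, ← Finset.sum_sub_distrib]

/-- The blocks of a family genuine on `labels1`, in `z`-coordinates. [cite: ChesterEtAl2020, §2.1 (`F^{ij,kl}_{∓,Δ,ℓ}`)] -/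
theorem blocks_of_genuineOn_labels1 {D : Dims} {Δ : ℝ} {ℓ : ℕ} {g : Label → ℝ → ℝ → ℝ}
    (hg : GenuineOn D labels1 Δ ℓ g) :
    ∀ L ∈ labels1, IsConformalBlock3D (d12 D L) (d34 D L) Δ ℓ (pullbackZ (g L)) :=
  fun L hL => hg L hL

/-- The six orderings on `labels1`: `tφtφ ↦ (d,d)`, `φttφ ↦ (−d,d)`, `φsφs ↦ (dₛ,dₛ)`, `sφφs ↦ (−dₛ,dₛ)`,
`φsφt ↦ (dₛ,−d)`, `sφφt ↦ (−dₛ,−d)` with `d = Δ_t − Δ_φ`, `dₛ = Δ_φ − Δ_s`. Bookkeeping.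
[cite: ChesterEtAl2020, §2.1 (`F^{ij,kl}_{∓,Δ,ℓ}`)] -/
theorem blocks1_of_forall {D : Dims} {Δ : ℝ} {ℓ : ℕ} {G : Label → ℝ → ℝ → ℝ}
    (hG : ∀ L ∈ labels1, IsConformalBlock3D (d12 D L) (d34 D L) Δ ℓ (G L)) :
    IsConformalBlock3D (D.Δt - D.Δφ) (D.Δt - D.Δφ) Δ ℓ (G .tφtφ) ∧
      IsConformalBlock3D (-(D.Δt - D.Δφ)) (D.Δt - D.Δφ) Δ ℓ (G .φttφ) ∧
      IsConformalBlock3D (D.Δφ - D.Δs) (D.Δφ - D.Δs) Δ ℓ (G .φsφs) ∧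
      IsConformalBlock3D (-(D.Δφ - D.Δs)) (D.Δφ - D.Δs) Δ ℓ (G .sφφs) ∧
      IsConformalBlock3D (D.Δφ - D.Δs) (-(D.Δt - D.Δφ)) Δ ℓ (G .φsφt) ∧
      IsConformalBlock3D (-(D.Δφ - D.Δs)) (-(D.Δt - D.Δφ)) Δ ℓ (G .sφφt) := by
  have h₁ := hG .tφtφ (by simp [labels1])
  have h₂ := hG .φttφ (by simp [labels1])
  have h₃ := hG .φsφs (by simp [labels1])
  have h₄ := hG .sφφs (by simp [labels1])
  have h₅ := hG .φsφt (by simp [labels1])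
  have h₆ := hG .sφφt (by simp [labels1])
  simp only [d12, d34] at h₁ h₂ h₃ h₄ h₅ h₆
  have hre₁ : D.Δφ - D.Δt = -(D.Δt - D.Δφ) := by ring
  have hre₂ : D.Δs - D.Δφ = -(D.Δφ - D.Δs) := by ring
  rw [hre₁] at h₂ h₅ h₆
  rw [hre₂] at h₄ h₆
  exact ⟨h₁, h₂, h₃, h₄, h₅, h₆⟩

/-- The exponent identity of the `φs` rows: `(Δ_φ + Δ_s)/2 + (Δ_φ − Δ_s)/2 = Δ_φ`. Bookkeeping.
[cite: ChesterEtAl2020, §2.1 (`F^{ij,kl}_{∓,Δ,ℓ}`)] -/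
theorem expo_φsφs_add_half (D : Dims) : D.expo .φsφs + (D.Δφ - D.Δs) / 2 = D.expo .sφφs := by
  simp only [Dims.expo]
  ring

/-- `Δ_φ` is the exponent of both the `sφφs` rows and the `sφφt` rows. Bookkeeping.
[cite: ChesterEtAl2020, §2.1 (`F^{ij,kl}_{∓,Δ,ℓ}`)] -/
theorem expo_sφφt_eq (D : Dims) : D.expo .sφφt = D.expo .sφφs := by
  simp only [Dims.expo]

/-- `Δ_φ + d = Δ_t`: the `sφφt` exponent shifted by the conjugation weight of `g^{d,−d}` is the `φttφ`
exponent. Bookkeeping. [cite: ChesterEtAl2020, §2.1 (`F^{ij,kl}_{∓,Δ,ℓ}`)] -/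
theorem expo_sφφs_add (D : Dims) : D.expo .sφφs + (D.Δt - D.Δφ) = D.expo .φttφ := by
  simp only [Dims.expo]
  ring

/-! #### Alignment of `W¹` by block conjugation

`G_{φsφt} = g^{dₛ,−d}` has the coefficient family `A_{n,j}(−dₛ/2, −d/2)`, misaligned with the diagonal
families `A(dₛ/2,dₛ/2)`, `A(d/2,d/2)` in BOTH slots; its conjugate `𝒞_{α}G_{φsφt}`, `α = (Δ₃₄−Δ₁₂)/2 =
−(d+dₛ)/2`, is the typed `g^{−dₛ,d}` (Dolan–Osborn 2011, eq. (2.44)) with the ALIGNED family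
`A(dₛ/2, d/2) = A(0,0)ρₛρₜ`, and on the open square `F^{s}_{σ}[G] = F^{s−α}_{σ}[𝒞_{α}G]`. -/

/-- The ALIGNED `φsφt` functional `W¹♮[H] = 2Φ₁₉[F⁻_{(Δφ+Δs)/2 + (d+dₛ)/2}H]` (`(Δφ+Δs)/2 + (d+dₛ)/2 = (Δφ+Δt)/2`),
to be applied to the conjugated block `g^{−dₛ,d}`. [cite: ChesterEtAl2020, App. «Crossing vectors» (`V⃗_{1,Δ,ℓ}`)]
[cite: DolanOsborn2011, §2 eqs. (2.43)–(2.44)] -/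
noncomputable def w1Form1A (F : ScanFunctional) (D : Dims) (H : ℝ → ℝ → ℝ) : ℝ :=
  2 * nodeEval F 19 (crossF (D.expo .φsφt - (-(D.Δt - D.Δφ) - (D.Δφ - D.Δs)) / 2) (-1) H)

/-- **Alignment identity** `W¹[H] = W¹♮[𝒞_{−(d+dₛ)/2} H]` for EVERY `H` (node algebra only).
[cite: DolanOsborn2011, §2 eqs. (2.43)–(2.44)] [cite: ChesterEtAl2020, App. «Crossing vectors» (`V⃗_{1,Δ,ℓ}`)] -/
theorem w1Form1_eq_w1Form1A (F : ScanFunctional) (D : Dims) (H : ℝ → ℝ → ℝ) :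
    w1Form1 F D H = w1Form1A F D (conjBlock ((-(D.Δt - D.Δφ) - (D.Δφ - D.Δs)) / 2) H) := by
  rw [w1Form1, w1Form1A, nodeEval_crossF_conjBlock, sub_add_cancel]

/-- The conjugated `φsφt` block is the typed `g^{−dₛ,d}`. [cite: DolanOsborn2011, §2 eqs. (2.43)–(2.44)] -/
theorem conj_φsφt {D : Dims} {Δ : ℝ} {ℓ : ℕ} {H : ℝ → ℝ → ℝ}
    (hH : IsConformalBlock3D (D.Δφ - D.Δs) (-(D.Δt - D.Δφ)) Δ ℓ H) :
    IsConformalBlock3D (-(D.Δφ - D.Δs)) (D.Δt - D.Δφ) Δ ℓ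
      (conjBlock ((-(D.Δt - D.Δφ) - (D.Δφ - D.Δs)) / 2) H) := by
  have h := hH.conj
  simp only [neg_neg] at h
  exact h

/-- The conjugated `φttφ` block `𝒞_{d}G_{φttφ} = v^{d}g^{−d,d}` is the typed `g^{d,−d}`.
[cite: DolanOsborn2011, §2 eqs. (2.43)–(2.44)] -/
theorem conj_φttφ {D : Dims} {Δ : ℝ} {ℓ : ℕ} {H : ℝ → ℝ → ℝ}
    (hH : IsConformalBlock3D (-(D.Δt - D.Δφ)) (D.Δt - D.Δφ) Δ ℓ H) :
    IsConformalBlock3D (D.Δt - D.Δφ) (-(D.Δt - D.Δφ)) Δ ℓ (conjBlock (D.Δt - D.Δφ) H) := by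
  have h := hH.conj
  simp only [neg_neg, sub_neg_eq_add, add_self_div_two] at h
  exact h

/-! ### §2 Budgets, the AM–GM absorption of `W²`, the dominating evaluations and the dominated form -/

/-- The `W²` budget weight `b = |w²⁰| + |w²¹|` (tree indices). [cite: PappadopuloRychkovEspinRattazzi2012, §5] -/
noncomputable def bWeight1 (F : ScanFunctional) (m : Fin F.M) : ℝ :=
  |F.w m 20| + |F.w m 21|

/-- The `W²` budget evaluation `T(b, −b; s)[G] = Σ_m b_m (v_m^s G(z_m) + u_m^s G(1−z_m))`.
[cite: PappadopuloRychkovEspinRattazzi2012, §5] -/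
noncomputable def bEval1 (F : ScanFunctional) (s : ℝ) (G : ℝ → ℝ → ℝ) : ℝ :=
  twoWeightEval (bWeight1 F) (fun m => -bWeight1 F m) F.z F.zb s G

/-- Direct weight of `𝔇₁ʸ`: `cʸ = 2(w⁹ + w¹¹) − 2(|w⁶| + |w⁷|) − κ⁻¹b`. [cite: PappadopuloRychkovEspinRattazzi2012, §5] -/
noncomputable def cWeightY1 (F : ScanFunctional) (κ : ℝ) (m : Fin F.M) : ℝ :=
  2 * (F.w m 9 + F.w m 11) - 2 * (|F.w m 6| + |F.w m 7|) - κ⁻¹ * bWeight1 F m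

/-- Reflected weight of `𝔇₁ʸ`: `dʸ = 2(w⁹ − w¹¹) + 2(|w⁶| + |w⁷|) + κ⁻¹b`. [cite: PappadopuloRychkovEspinRattazzi2012, §5] -/
noncomputable def dWeightY1 (F : ScanFunctional) (κ : ℝ) (m : Fin F.M) : ℝ :=
  2 * (F.w m 9 - F.w m 11) + 2 * (|F.w m 6| + |F.w m 7|) + κ⁻¹ * bWeight1 F m

/-- **The dominating evaluation of the `y²` block**: `𝔇₁ʸ[G] = T(cʸ, dʸ; Δ_t)[G]`, applied to `G = G_{φttφ} = g^{−d,d}`.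
[cite: PappadopuloRychkovEspinRattazzi2012, §5] -/
noncomputable def domY1Eval (F : ScanFunctional) (D : Dims) (κ : ℝ) (G : ℝ → ℝ → ℝ) : ℝ :=
  twoWeightEval (cWeightY1 F κ) (dWeightY1 F κ) F.z F.zb (D.expo .φttφ) G

/-- The dominated `y²` term at `𝒫_{E,j}`. [cite: PappadopuloRychkovEspinRattazzi2012, §5] -/
noncomputable def domY1Term (F : ScanFunctional) (D : Dims) (κ E : ℝ) (j : ℕ) : ℝ :=
  domY1Eval F D κ (zMono E j)

/-- `𝔇₁ʸ` split along the rows. Bookkeeping. [cite: PappadopuloRychkovEspinRattazzi2012, §5] -/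
theorem domY1Eval_eq (F : ScanFunctional) (D : Dims) (κ : ℝ) (G : ℝ → ℝ → ℝ) :
    domY1Eval F D κ G = 2 * nodeEval F 9 (crossF (D.expo .φttφ) (-1) G) +
        2 * nodeEval F 11 (crossF (D.expo .φttφ) 1 G) -
      2 * twoWeightEval (fun m => |F.w m 6|) (fun m => -|F.w m 6|) F.z F.zb (D.expo .φttφ) G -
      2 * twoWeightEval (fun m => |F.w m 7|) (fun m => -|F.w m 7|) F.z F.zb (D.expo .φttφ) G -
      κ⁻¹ * bEval1 F (D.expo .φttφ) G := by
  simp only [domY1Eval, bEval1, twoWeightEval, nodeEval_apply, crossF, Finset.mul_sum,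
    ← Finset.sum_add_distrib, ← Finset.sum_sub_distrib]
  exact Finset.sum_congr rfl fun m _ => by simp only [cWeightY1, dWeightY1]; ring

/-- `𝔇₁ʸ` as two point functionals: weights `2w⁹` on `F⁻_{Δt}` and `2w¹¹ − 2(|w⁶|+|w⁷|) − κ⁻¹b` on `F⁺_{Δt}`.
Bookkeeping. [cite: PappadopuloRychkovEspinRattazzi2012, §5] -/
theorem domY1Eval_eq_pointFunctional_add (F : ScanFunctional) (D : Dims) (κ : ℝ) (G : ℝ → ℝ → ℝ) :
    domY1Eval F D κ G = pointFunctional (fun m => 2 * F.w m 9) F.z F.zb (crossF (D.expo .φttφ) (-1) G) +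
      pointFunctional (fun m => 2 * F.w m 11 - 2 * (|F.w m 6| + |F.w m 7|) - κ⁻¹ * bWeight1 F m) F.z F.zb
        (crossF (D.expo .φttφ) 1 G) := by
  simp only [domY1Eval, twoWeightEval, pointFunctional_apply, crossF, ← Finset.sum_add_distrib]
  exact Finset.sum_congr rfl fun m _ => by simp only [cWeightY1, dWeightY1]; ring

/-- **`𝔇₁ʸ[G_{φttφ}] + κ⁻¹·T(b,−b;Δ_t)[G_{φttφ}] ≤ Y_ε[G]`** for `|ε| ≤ 1` on genuine blocks at a regular
`(Δ, ℓ)` above the bound (`Δ ≠ 1` if `ℓ = 0`): the `tφtφ` rows by Cauchy–Schwarz.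
[cite: PappadopuloRychkovEspinRattazzi2012, §5] [cite: ChesterEtAl2020, §3.1 (functional conditions)] -/
theorem domY1Eval_add_le_yForm1 (F : ScanFunctional) (D : Dims) (κ : ℝ) {ε : ℝ} (hε : |ε| ≤ 1) {Δ : ℝ}
    {ℓ : ℕ} (hΔ : unitarityBound3D ℓ < Δ) (hreg : ¬ accidentalDegeneracy3D Δ ℓ) (h1 : ℓ = 0 → Δ ≠ 1)
    {G : Label → ℝ → ℝ → ℝ} (hG₁ : IsConformalBlock3D (D.Δt - D.Δφ) (D.Δt - D.Δφ) Δ ℓ (G .tφtφ))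
    (hG₂ : IsConformalBlock3D (-(D.Δt - D.Δφ)) (D.Δt - D.Δφ) Δ ℓ (G .φttφ)) :
    domY1Eval F D κ (G .φttφ) + κ⁻¹ * bEval1 F (D.expo .φttφ) (G .φttφ) ≤ yForm1 F D ε G := by
  have h6 := abs_nodeEval_crossF_gmm_le F 6 (σ := -1) (by simp) hΔ hreg h1 hG₁ hG₂ (D.expo .tφtφ)
  have h7 := abs_nodeEval_crossF_gmm_le F 7 (σ := 1) (by simp) hΔ hreg h1 hG₁ hG₂ (D.expo .tφtφ)
  rw [expo_tφtφ_add_half] at h6 h7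
  have h6' := mul_le_mul hε h6 (abs_nonneg _) zero_le_one
  have h7' := mul_le_mul hε h7 (abs_nonneg _) zero_le_one
  rw [← abs_mul, one_mul] at h6' h7'
  rw [domY1Eval_eq, yForm1]
  have a6 := neg_abs_le (ε * nodeEval F 6 (crossF (D.expo .tφtφ) (-1) (G .tφtφ)))
  have a7 := neg_abs_le (ε * nodeEval F 7 (crossF (D.expo .tφtφ) 1 (G .tφtφ)))
  nlinarith [a6, a7, h6', h7']

/-- Direct weight of `𝔇₁ˣ`: `cˣ = 2(w¹⁷ − w¹⁸) − 2|w¹³| − κb` (tree indices). [cite: PappadopuloRychkovEspinRattazzi2012, §5] -/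
noncomputable def cWeightX1 (F : ScanFunctional) (κ : ℝ) (m : Fin F.M) : ℝ :=
  2 * (F.w m 17 - F.w m 18) - 2 * |F.w m 13| - κ * bWeight1 F m

/-- Reflected weight of `𝔇₁ˣ`: `dˣ = 2(w¹⁷ + w¹⁸) + 2|w¹³| + κb`. [cite: PappadopuloRychkovEspinRattazzi2012, §5] -/
noncomputable def dWeightX1 (F : ScanFunctional) (κ : ℝ) (m : Fin F.M) : ℝ :=
  2 * (F.w m 17 + F.w m 18) + 2 * |F.w m 13| + κ * bWeight1 F m

/-- **The dominating evaluation of the `x²` block**: `𝔇₁ˣ[G] = T(cˣ, dˣ; Δ_φ)[G]`, applied to `G = G_{sφφs} = g^{−dₛ,dₛ}`.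
[cite: PappadopuloRychkovEspinRattazzi2012, §5] -/
noncomputable def domX1Eval (F : ScanFunctional) (D : Dims) (κ : ℝ) (G : ℝ → ℝ → ℝ) : ℝ :=
  twoWeightEval (cWeightX1 F κ) (dWeightX1 F κ) F.z F.zb (D.expo .sφφs) G

/-- The dominated `x²` term at `𝒫_{E,j}`. [cite: PappadopuloRychkovEspinRattazzi2012, §5] -/
noncomputable def domX1Term (F : ScanFunctional) (D : Dims) (κ E : ℝ) (j : ℕ) : ℝ :=
  domX1Eval F D κ (zMono E j)

/-- `𝔇₁ˣ` split along the rows. Bookkeeping. [cite: PappadopuloRychkovEspinRattazzi2012, §5] -/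
theorem domX1Eval_eq (F : ScanFunctional) (D : Dims) (κ : ℝ) (G : ℝ → ℝ → ℝ) :
    domX1Eval F D κ G = 2 * nodeEval F 17 (crossF (D.expo .sφφs) (-1) G) -
        2 * nodeEval F 18 (crossF (D.expo .sφφs) 1 G) -
      2 * twoWeightEval (fun m => |F.w m 13|) (fun m => -|F.w m 13|) F.z F.zb (D.expo .sφφs) G -
      κ * bEval1 F (D.expo .sφφs) G := by
  simp only [domX1Eval, bEval1, twoWeightEval, nodeEval_apply, crossF, Finset.mul_sum,
    ← Finset.sum_sub_distrib]
  exact Finset.sum_congr rfl fun m _ => by simp only [cWeightX1, dWeightX1]; ring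

/-- `𝔇₁ˣ` as two point functionals: weights `2w¹⁷` on `F⁻_{Δφ}` and `−2w¹⁸ − 2|w¹³| − κb` on `F⁺_{Δφ}`.
Bookkeeping. [cite: PappadopuloRychkovEspinRattazzi2012, §5] -/
theorem domX1Eval_eq_pointFunctional_add (F : ScanFunctional) (D : Dims) (κ : ℝ) (G : ℝ → ℝ → ℝ) :
    domX1Eval F D κ G = pointFunctional (fun m => 2 * F.w m 17) F.z F.zb (crossF (D.expo .sφφs) (-1) G) +
      pointFunctional (fun m => -(2 * F.w m 18) - 2 * |F.w m 13| - κ * bWeight1 F m) F.z F.zb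
        (crossF (D.expo .sφφs) 1 G) := by
  simp only [domX1Eval, twoWeightEval, pointFunctional_apply, crossF, ← Finset.sum_add_distrib]
  exact Finset.sum_congr rfl fun m _ => by simp only [cWeightX1, dWeightX1]; ring

/-- **`𝔇₁ˣ[G_{sφφs}] + κ·T(b,−b;Δ_φ)[G_{sφφs}] ≤ X_ε[G]`** for `|ε| ≤ 1` on genuine blocks at a regular
`(Δ, ℓ)` above the bound (`Δ ≠ 1` if `ℓ = 0`): the `φsφs` row by Cauchy–Schwarz.
[cite: PappadopuloRychkovEspinRattazzi2012, §5] [cite: ChesterEtAl2020, §3.1 (functional conditions)] -/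
theorem domX1Eval_add_le_xForm1 (F : ScanFunctional) (D : Dims) (κ : ℝ) {ε : ℝ} (hε : |ε| ≤ 1) {Δ : ℝ}
    {ℓ : ℕ} (hΔ : unitarityBound3D ℓ < Δ) (hreg : ¬ accidentalDegeneracy3D Δ ℓ) (h1 : ℓ = 0 → Δ ≠ 1)
    {G : Label → ℝ → ℝ → ℝ} (hG₁ : IsConformalBlock3D (D.Δφ - D.Δs) (D.Δφ - D.Δs) Δ ℓ (G .φsφs))
    (hG₂ : IsConformalBlock3D (-(D.Δφ - D.Δs)) (D.Δφ - D.Δs) Δ ℓ (G .sφφs)) :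
    domX1Eval F D κ (G .sφφs) + κ * bEval1 F (D.expo .sφφs) (G .sφφs) ≤ xForm1 F D ε G := by
  have h13 := abs_nodeEval_crossF_gmm_le F 13 (σ := -1) (by simp) hΔ hreg h1 hG₁ hG₂ (D.expo .φsφs)
  rw [expo_φsφs_add_half] at h13
  have h13' := mul_le_mul hε h13 (abs_nonneg _) zero_le_one
  rw [← abs_mul, one_mul] at h13'
  rw [domX1Eval_eq, xForm1]
  have a13 := neg_abs_le (ε * nodeEval F 13 (crossF (D.expo .φsφs) (-1) (G .φsφs)))
  nlinarith [a13, h13']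

/-! #### The block-level AM–GM absorption of `W²` -/

/-- **Block-level AM–GM bound of the misaligned block `g^{−dₛ,−d}` by its reflection-positive partners**:
for typed `G_T = g^{−d,d}`, `G_S = g^{−dₛ,dₛ}`, `H = g^{−dₛ,−d}` at `Δ` strictly above the bound
(`Δ ≠ 1` if `ℓ = 0`), every point of the open square and every `θ > 0`,
`|H(x,y)| ≤ (θ·G_S(x,y) + θ⁻¹·v^{d}·G_T(x,y))/2`, `v = (1−x)(1−y)`: termwise
`T_q(dₛ/2,−d/2)² = T_q(dₛ/2,dₛ/2)·T_q(−d/2,−d/2)`, the second partner series summing to the conjugated block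
`𝒞_{d}G_T = g^{d,−d}`. [cite: DolanOsborn2004, §3 eq. (3.11)] [cite: KosPolandSimmonsduffin2014, §4 eqs. (4.2)–(4.3)]
[cite: DolanOsborn2011, §2 eqs. (2.43)–(2.44)] -/
theorem abs_sφφt_le (D : Dims) {Δ θ : ℝ} {ℓ : ℕ} (hΔ : unitarityBound3D ℓ < Δ) (h1 : ℓ = 0 → Δ ≠ 1)
    {GT GS H : ℝ → ℝ → ℝ} (hGT : IsConformalBlock3D (-(D.Δt - D.Δφ)) (D.Δt - D.Δφ) Δ ℓ GT)
    (hGS : IsConformalBlock3D (-(D.Δφ - D.Δs)) (D.Δφ - D.Δs) Δ ℓ GS)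
    (hH : IsConformalBlock3D (-(D.Δφ - D.Δs)) (-(D.Δt - D.Δφ)) Δ ℓ H) (hθ : 0 < θ)
    {x y : ℝ} (hx : x ∈ Ioo (0 : ℝ) 1) (hy : y ∈ Ioo (0 : ℝ) 1) :
    |H x y| ≤ (θ * GS x y + ((1 - x) * (1 - y)) ^ (D.Δt - D.Δφ) * GT x y / θ) / 2 := by
  have hT := (hH.hasSum_hrZTermAB_general_of_lt hΔ h1 hx hy).1
  have hP := (hGS.hasSum_hrZTermAB_general_of_lt hΔ h1 hx hy).1
  have hQ := ((conj_φttφ hGT).hasSum_hrZTermAB_general_of_lt hΔ h1 hx hy).1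
  simp only [neg_neg] at hT hP
  have hcb : conjBlock (D.Δt - D.Δφ) GT x y = ((1 - x) * (1 - y)) ^ (D.Δt - D.Δφ) * GT x y := rfl
  rw [hcb] at hQ
  exact abs_le_am_of_hasSum_sq_eq_mul hθ (fun q => hrZTermAB_sq_eq_self_mul_self hΔ h1 _ _ x y q)
    (fun q => hrZTermAB_self_nonneg _ hΔ hx.1.le hy.1.le q)
    (fun q => hrZTermAB_self_nonneg _ hΔ hx.1.le hy.1.le q) hP hQ hT

/-- Scalar AM–GM with the `(x,y)`-adapted parameter `θ = κ|x|/|y|`: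
`|x·y|·|h| ≤ (κx²A + κ⁻¹y²c)/2` whenever `|h| ≤ (θA + c/θ)/2` for all `θ > 0` (`A, c ≥ 0`).
[cite: PappadopuloRychkovEspinRattazzi2012, §5] -/
private theorem abs_xy_mul_le {h A c x y κ : ℝ} (hκ : 0 < κ) (hA : 0 ≤ A) (hc : 0 ≤ c)
    (hh : ∀ θ : ℝ, 0 < θ → |h| ≤ (θ * A + c / θ) / 2) :
    |x * y| * |h| ≤ (κ * x ^ 2 * A + κ⁻¹ * y ^ 2 * c) / 2 := by
  by_cases hx : x = 0
  · have e : |x * y| * |h| = 0 := by rw [hx, zero_mul, abs_zero, zero_mul]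
    rw [e]
    positivity
  by_cases hy : y = 0
  · have e : |x * y| * |h| = 0 := by rw [hy, mul_zero, abs_zero, zero_mul]
    rw [e]
    positivity
  have hax : 0 < |x| := abs_pos.mpr hx
  have hay : 0 < |y| := abs_pos.mpr hy
  have haxne : |x| ≠ 0 := hax.ne'
  have hayne : |y| ≠ 0 := hay.ne'
  have hκne : κ ≠ 0 := hκ.ne'
  have hθ : 0 < κ * |x| / |y| := by positivity
  have h2 := mul_le_mul_of_nonneg_left (hh _ hθ) (abs_nonneg (x * y))
  refine h2.trans (le_of_eq ?_)
  rw [abs_mul, ← sq_abs x, ← sq_abs y]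
  field_simp

/-- One node of `x·y·ε·W² +` budgets is non-negative: `p, q` the direct / reflected node values of the
misaligned block (times `v^s`, `u^s`), `A, A'` resp. `B, B'` those of the two budgets.
[cite: PappadopuloRychkovEspinRattazzi2012, §5] -/
private theorem node_w2_nonneg {x y ε κ w₀ w₁ p q A A' B B' : ℝ} (hε : |ε| ≤ 1) (hκ : 0 < κ)
    (hA : 0 ≤ A) (hA' : 0 ≤ A') (hB : 0 ≤ B) (hB' : 0 ≤ B')
    (hp : ∀ θ : ℝ, 0 < θ → |p| ≤ (θ * A + B / θ) / 2)
    (hq : ∀ θ : ℝ, 0 < θ → |q| ≤ (θ * A' + B' / θ) / 2) :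
    0 ≤ x * y * (ε * (2 * (w₀ * (p + -1 * q)) + 2 * (w₁ * (p + 1 * q)))) +
      (|w₀| + |w₁|) * (κ * x ^ 2 * (A + A') + κ⁻¹ * y ^ 2 * (B + B')) := by
  have hP := abs_xy_mul_le (x := x) (y := y) hκ hA hB hp
  have hQ := abs_xy_mul_le (x := x) (y := y) hκ hA' hB' hq
  set P := x * y * p with hPdef
  set Q := x * y * q with hQdef
  have hPabs : |P| = |x * y| * |p| := by rw [hPdef, abs_mul]
  have hQabs : |Q| = |x * y| * |q| := by rw [hQdef, abs_mul]
  have hE : x * y * (ε * (2 * (w₀ * (p + -1 * q)) + 2 * (w₁ * (p + 1 * q)))) =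
      ε * (2 * w₀ * (P - Q) + 2 * w₁ * (P + Q)) := by
    rw [hPdef, hQdef]; ring
  have hd : |P - Q| ≤ |P| + |Q| := by
    simpa only [sub_eq_add_neg, abs_neg] using abs_add_le P (-Q)
  have hs : |P + Q| ≤ |P| + |Q| := abs_add_le P Q
  have h0 : |2 * w₀ * (P - Q) + 2 * w₁ * (P + Q)| ≤ (|w₀| + |w₁|) * (2 * |P| + 2 * |Q|) := by
    refine (abs_add_le _ _).trans ?_
    simp only [abs_mul, abs_two]
    nlinarith [abs_nonneg w₀, abs_nonneg w₁, hd, hs, abs_nonneg P, abs_nonneg Q]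
  have hEabs : |ε * (2 * w₀ * (P - Q) + 2 * w₁ * (P + Q))| ≤ (|w₀| + |w₁|) * (2 * |P| + 2 * |Q|) := by
    rw [abs_mul]
    calc |ε| * |2 * w₀ * (P - Q) + 2 * w₁ * (P + Q)|
        ≤ 1 * ((|w₀| + |w₁|) * (2 * |P| + 2 * |Q|)) := mul_le_mul hε h0 (abs_nonneg _) zero_le_one
      _ = (|w₀| + |w₁|) * (2 * |P| + 2 * |Q|) := one_mul _
  have hW : 0 ≤ |w₀| + |w₁| := by positivity
  have h3 : (|w₀| + |w₁|) * (2 * |P| + 2 * |Q|) ≤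
      (|w₀| + |w₁|) * (κ * x ^ 2 * (A + A') + κ⁻¹ * y ^ 2 * (B + B')) := by
    refine mul_le_mul_of_nonneg_left ?_ hW
    rw [hPabs, hQabs]
    linarith [hP, hQ]
  rw [hE]
  linarith [neg_abs_le (ε * (2 * w₀ * (P - Q) + 2 * w₁ * (P + Q))), hEabs, h3]

/-- The AM–GM hypothesis at a node, direct value: `|v^{Δφ}H(z)| ≤ (θ·v^{Δφ}G_S(z) + v^{Δt}G_T(z)/θ)/2`.
[cite: PappadopuloRychkovEspinRattazzi2012, §5] [cite: DolanOsborn2011, §2 eqs. (2.43)–(2.44)] -/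
private theorem node_hyp (D : Dims) {Δ : ℝ} {ℓ : ℕ} (hΔ : unitarityBound3D ℓ < Δ) (h1 : ℓ = 0 → Δ ≠ 1)
    {GT GS H : ℝ → ℝ → ℝ} (hGT : IsConformalBlock3D (-(D.Δt - D.Δφ)) (D.Δt - D.Δφ) Δ ℓ GT)
    (hGS : IsConformalBlock3D (-(D.Δφ - D.Δs)) (D.Δφ - D.Δs) Δ ℓ GS)
    (hH : IsConformalBlock3D (-(D.Δφ - D.Δs)) (-(D.Δt - D.Δφ)) Δ ℓ H) {z zb : ℝ}
    (hz : z ∈ Ioo (0 : ℝ) 1) (hzb : zb ∈ Ioo (0 : ℝ) 1) (θ : ℝ) (hθ : 0 < θ) :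
    |((1 - z) * (1 - zb)) ^ D.expo .sφφt * H z zb| ≤
      (θ * (((1 - z) * (1 - zb)) ^ D.expo .sφφs * GS z zb) +
        ((1 - z) * (1 - zb)) ^ D.expo .φttφ * GT z zb / θ) / 2 := by
  have hv : 0 < (1 - z) * (1 - zb) := mul_pos (by linarith [hz.2]) (by linarith [hzb.2])
  have hb := abs_sφφt_le D hΔ h1 hGT hGS hH hθ hz hzb
  have hvs := Real.rpow_pos_of_pos hv (D.expo .sφφs)
  rw [expo_sφφt_eq, ← expo_sφφs_add, Real.rpow_add hv, abs_mul, abs_of_pos hvs]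
  calc ((1 - z) * (1 - zb)) ^ D.expo .sφφs * |H z zb|
      ≤ ((1 - z) * (1 - zb)) ^ D.expo .sφφs *
          ((θ * GS z zb + ((1 - z) * (1 - zb)) ^ (D.Δt - D.Δφ) * GT z zb / θ) / 2) :=
        mul_le_mul_of_nonneg_left hb hvs.le
    _ = _ := by ring

/-- The AM–GM hypothesis at a node, reflected value: `|u^{Δφ}H(1−z)| ≤ (θ·u^{Δφ}G_S(1−z) + u^{Δt}G_T(1−z)/θ)/2`.
[cite: PappadopuloRychkovEspinRattazzi2012, §5] [cite: DolanOsborn2011, §2 eqs. (2.43)–(2.44)] -/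
private theorem node_hyp' (D : Dims) {Δ : ℝ} {ℓ : ℕ} (hΔ : unitarityBound3D ℓ < Δ) (h1 : ℓ = 0 → Δ ≠ 1)
    {GT GS H : ℝ → ℝ → ℝ} (hGT : IsConformalBlock3D (-(D.Δt - D.Δφ)) (D.Δt - D.Δφ) Δ ℓ GT)
    (hGS : IsConformalBlock3D (-(D.Δφ - D.Δs)) (D.Δφ - D.Δs) Δ ℓ GS)
    (hH : IsConformalBlock3D (-(D.Δφ - D.Δs)) (-(D.Δt - D.Δφ)) Δ ℓ H) {z zb : ℝ}
    (hz : z ∈ Ioo (0 : ℝ) 1) (hzb : zb ∈ Ioo (0 : ℝ) 1) (θ : ℝ) (hθ : 0 < θ) :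
    |(z * zb) ^ D.expo .sφφt * H (1 - z) (1 - zb)| ≤
      (θ * ((z * zb) ^ D.expo .sφφs * GS (1 - z) (1 - zb)) +
        (z * zb) ^ D.expo .φttφ * GT (1 - z) (1 - zb) / θ) / 2 := by
  have hu : 0 < z * zb := mul_pos hz.1 hzb.1
  have hb := abs_sφφt_le D hΔ h1 hGT hGS hH hθ (x := 1 - z) (y := 1 - zb)
    ⟨by linarith [hz.2], by linarith [hz.1]⟩ ⟨by linarith [hzb.2], by linarith [hzb.1]⟩
  simp only [sub_sub_cancel] at hb
  have hus := Real.rpow_pos_of_pos hu (D.expo .sφφs)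
  rw [expo_sφφt_eq, ← expo_sφφs_add, Real.rpow_add hu, abs_mul, abs_of_pos hus]
  calc (z * zb) ^ D.expo .sφφs * |H (1 - z) (1 - zb)|
      ≤ (z * zb) ^ D.expo .sφφs *
          ((θ * GS (1 - z) (1 - zb) + (z * zb) ^ (D.Δt - D.Δφ) * GT (1 - z) (1 - zb) / θ) / 2) :=
        mul_le_mul_of_nonneg_left hb hus.le
    _ = _ := by ring

/-- **The AM–GM absorption of `W²`**: for `|ε| ≤ 1`, `κ > 0`, genuine blocks at a regular `(Δ, ℓ)` above
the bound (`Δ ≠ 1` if `ℓ = 0`) and every `(x, y)`,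
`x·y·ε·W²[G_{sφφt}] ≥ −(κ·x²·T(b,−b;Δ_φ)[G_{sφφs}] + κ⁻¹·y²·T(b,−b;Δ_t)[G_{φttφ}])` — node by node
`|F^{s}_{σ}[H](z)| ≤ v^s|H(z)| + u^s|H(1−z)|`, then `abs_sφφt_le` with `θ = κ|x|/|y|` at the node and at its
mirror (`v^{Δφ}·v^{d} = v^{Δt}`). [cite: PappadopuloRychkovEspinRattazzi2012, §5]
[cite: KosPolandSimmonsduffin2014, §4 eqs. (4.2)–(4.3)] [cite: DolanOsborn2011, §2 eqs. (2.43)–(2.44)] -/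
theorem xy_w2_lower (F : ScanFunctional) (D : Dims) {ε κ : ℝ} (hε : |ε| ≤ 1) (hκ : 0 < κ) {Δ : ℝ}
    {ℓ : ℕ} (hΔ : unitarityBound3D ℓ < Δ) (hreg : ¬ accidentalDegeneracy3D Δ ℓ) (h1 : ℓ = 0 → Δ ≠ 1)
    {G : Label → ℝ → ℝ → ℝ} (hG₂ : IsConformalBlock3D (-(D.Δt - D.Δφ)) (D.Δt - D.Δφ) Δ ℓ (G .φttφ))
    (hG₄ : IsConformalBlock3D (-(D.Δφ - D.Δs)) (D.Δφ - D.Δs) Δ ℓ (G .sφφs))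
    (hG₆ : IsConformalBlock3D (-(D.Δφ - D.Δs)) (-(D.Δt - D.Δφ)) Δ ℓ (G .sφφt)) (x y : ℝ) :
    -(κ * x ^ 2 * bEval1 F (D.expo .sφφs) (G .sφφs) +
        κ⁻¹ * y ^ 2 * bEval1 F (D.expo .φttφ) (G .φttφ)) ≤
      x * y * (ε * w2Form1 F D (G .sφφt)) := by
  rw [← sub_nonneg]
  have e : x * y * (ε * w2Form1 F D (G .sφφt)) -
      -(κ * x ^ 2 * bEval1 F (D.expo .sφφs) (G .sφφs) +
        κ⁻¹ * y ^ 2 * bEval1 F (D.expo .φttφ) (G .φttφ)) =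
      ∑ m : Fin F.M, (x * y * (ε * (2 * (F.w m 20 *
          (((1 - F.z m) * (1 - F.zb m)) ^ D.expo .sφφt * G .sφφt (F.z m) (F.zb m) +
            -1 * ((F.z m * F.zb m) ^ D.expo .sφφt * G .sφφt (1 - F.z m) (1 - F.zb m)))) +
          2 * (F.w m 21 *
          (((1 - F.z m) * (1 - F.zb m)) ^ D.expo .sφφt * G .sφφt (F.z m) (F.zb m) +
            1 * ((F.z m * F.zb m) ^ D.expo .sφφt * G .sφφt (1 - F.z m) (1 - F.zb m)))))) +
        (|F.w m 20| + |F.w m 21|) *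
          (κ * x ^ 2 * (((1 - F.z m) * (1 - F.zb m)) ^ D.expo .sφφs * G .sφφs (F.z m) (F.zb m) +
              (F.z m * F.zb m) ^ D.expo .sφφs * G .sφφs (1 - F.z m) (1 - F.zb m)) +
            κ⁻¹ * y ^ 2 * (((1 - F.z m) * (1 - F.zb m)) ^ D.expo .φttφ * G .φttφ (F.z m) (F.zb m) +
              (F.z m * F.zb m) ^ D.expo .φttφ * G .φttφ (1 - F.z m) (1 - F.zb m)))) := by
    simp only [w2Form1, nodeEval_apply, bEval1, twoWeightEval, bWeight1, crossF, Finset.mul_sum,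
      sub_neg_eq_add, ← Finset.sum_add_distrib]
    exact Finset.sum_congr rfl fun m _ => by ring
  rw [e]
  refine Finset.sum_nonneg fun m _ => ?_
  have hz := F.hz m
  have hzb := F.hzb m
  have hv : 0 < (1 - F.z m) * (1 - F.zb m) := mul_pos (by linarith [hz.2]) (by linarith [hzb.2])
  have hu : 0 < F.z m * F.zb m := mul_pos hz.1 hzb.1
  have hz' : 1 - F.z m ∈ Ioo (0 : ℝ) 1 := ⟨by linarith [hz.2], by linarith [hz.1]⟩
  have hzb' : 1 - F.zb m ∈ Ioo (0 : ℝ) 1 := ⟨by linarith [hzb.2], by linarith [hzb.1]⟩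
  have gS := hG₄.nonneg_offdiag_of_neg_eq hΔ hreg rfl hz hzb
  have gS' := hG₄.nonneg_offdiag_of_neg_eq hΔ hreg rfl hz' hzb'
  have gT := hG₂.nonneg_offdiag_of_neg_eq hΔ hreg rfl hz hzb
  have gT' := hG₂.nonneg_offdiag_of_neg_eq hΔ hreg rfl hz' hzb'
  exact node_w2_nonneg hε hκ (mul_nonneg (Real.rpow_pos_of_pos hv _).le gS)
    (mul_nonneg (Real.rpow_pos_of_pos hu _).le gS') (mul_nonneg (Real.rpow_pos_of_pos hv _).le gT)
    (mul_nonneg (Real.rpow_pos_of_pos hu _).le gT')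
    (node_hyp D hΔ h1 hG₂ hG₄ hG₆ hz hzb) (node_hyp' D hΔ h1 hG₂ hG₄ hG₆ hz hzb)

/-- **The dominated charge-`1` form**: `𝔇₁(x,y) = x²·𝔇₁ˣ[G_{sφφs}] + y²·𝔇₁ʸ[G_{φttφ}] + xy·W¹[G_{φsφt}]`.
[cite: PappadopuloRychkovEspinRattazzi2012, §5] [cite: ChesterEtAl2020, App. «Crossing vectors» (`V⃗_{1,Δ,ℓ}`)] -/
noncomputable def dom1Form (F : ScanFunctional) (D : Dims) (κ : ℝ) (G : Label → ℝ → ℝ → ℝ) (x y : ℝ) : ℝ :=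
  x ^ 2 * domX1Eval F D κ (G .sφφs) + y ^ 2 * domY1Eval F D κ (G .φttφ) + x * y * w1Form1 F D (G .φsφt)

/-- **`𝔇₁(x,y) ≤ (x y) α(V⃗_1[ε]) (x;y)`** at the `z`-level for every `(x, y)`, `|ε| ≤ 1`, `κ > 0`.
[cite: PappadopuloRychkovEspinRattazzi2012, §5] [cite: ChesterEtAl2020, §3.1 (functional conditions)] -/
theorem dom1Form_le_sector1Form (F : ScanFunctional) (D : Dims) {ε κ : ℝ} (hε : |ε| ≤ 1) (hκ : 0 < κ)
    {Δ : ℝ} {ℓ : ℕ} (hΔ : unitarityBound3D ℓ < Δ) (hreg : ¬ accidentalDegeneracy3D Δ ℓ)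
    (h1 : ℓ = 0 → Δ ≠ 1) {G : Label → ℝ → ℝ → ℝ}
    (hG₁ : IsConformalBlock3D (D.Δt - D.Δφ) (D.Δt - D.Δφ) Δ ℓ (G .tφtφ))
    (hG₂ : IsConformalBlock3D (-(D.Δt - D.Δφ)) (D.Δt - D.Δφ) Δ ℓ (G .φttφ))
    (hG₃ : IsConformalBlock3D (D.Δφ - D.Δs) (D.Δφ - D.Δs) Δ ℓ (G .φsφs))
    (hG₄ : IsConformalBlock3D (-(D.Δφ - D.Δs)) (D.Δφ - D.Δs) Δ ℓ (G .sφφs))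
    (hG₆ : IsConformalBlock3D (-(D.Δφ - D.Δs)) (-(D.Δt - D.Δφ)) Δ ℓ (G .sφφt)) (x y : ℝ) :
    dom1Form F D κ G x y ≤ sector1Form F D ε G x y := by
  have HY := domY1Eval_add_le_yForm1 F D κ hε hΔ hreg h1 hG₁ hG₂
  have HX := domX1Eval_add_le_xForm1 F D κ hε hΔ hreg h1 hG₃ hG₄
  have HW := xy_w2_lower F D hε hκ hΔ hreg h1 hG₂ hG₄ hG₆ x y
  have HX2 := mul_le_mul_of_nonneg_left HX (sq_nonneg x)
  have HY2 := mul_le_mul_of_nonneg_left HY (sq_nonneg y)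
  rw [dom1Form, sector1Form, wForm1]
  linarith [HX2, HY2, HW]

/-! ### §3 The term form, the rank-one coefficient structure and the termwise rule -/

/-- `ρₛ = ρ(dₛ/2)` (block `g^{−dₛ,dₛ}` and the first slot of the aligned `g^{−dₛ,d}`). [cite: DolanOsborn2004, §3 eq. (3.11)] -/
noncomputable def rhoS1 (D : Dims) (Δ : ℝ) (ℓ n j : ℕ) : ℝ :=
  doPochRatio ((D.Δφ - D.Δs) / 2) Δ ℓ n j

/-- `ρₜ = ρ(d/2)` (block `g^{−d,d}` and the second slot of the aligned `g^{−dₛ,d}`). [cite: DolanOsborn2004, §3 eq. (3.11)] -/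
noncomputable def rhoT1 (D : Dims) (Δ : ℝ) (ℓ n j : ℕ) : ℝ :=
  doPochRatio ((D.Δt - D.Δφ) / 2) Δ ℓ n j

/-- **The charge-`1` term form at level `(n,j)`**:
`𝔗_{n,j}(x,y) = x²ρₛ²𝔇ˣ[𝒫] + y²ρₜ²𝔇ʸ[𝒫] + xy·ρₛρₜ·W¹♮[𝒫] = (ρₛx, ρₜy) M_{n,j} (ρₛx, ρₜy)ᵀ`, `𝒫 = 𝒫_{Δ+n,j}`,
`M_{n,j} = [[𝔇ˣ, W¹♮/2], [W¹♮/2, 𝔇ʸ]]` — an explicit binary form in `(x, y)`.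
[cite: HogervorstRychkov2013, §3 eq. (3.9)] [cite: DolanOsborn2004, §3 eq. (3.11)] -/
noncomputable def dom1TermForm (F : ScanFunctional) (D : Dims) (κ Δ : ℝ) (ℓ n j : ℕ) (x y : ℝ) : ℝ :=
  x ^ 2 * (rhoS1 D Δ ℓ n j ^ 2 * domX1Term F D κ (Δ + (n : ℝ)) j) +
      y ^ 2 * (rhoT1 D Δ ℓ n j ^ 2 * domY1Term F D κ (Δ + (n : ℝ)) j) +
    x * y * (rhoS1 D Δ ℓ n j * rhoT1 D Δ ℓ n j * w1Form1A F D (zMono (Δ + (n : ℝ)) j))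

/-- **The per-term client test is `ρ`-FREE**: `𝔇ˣ_q ≥ 0`, `𝔇ʸ_q ≥ 0`, `(W¹♮_q)² ≤ 4𝔇ˣ_q𝔇ʸ_q` (kernel values at
`𝒫_{Δ+n,j}` only) give `𝔗_{n,j}(x,y) ≥ 0` for all `(x, y)` — `M_{n,j} ⪰ 0` is preserved by the congruence
`diag(ρₛ, ρₜ)`. [cite: ChesterEtAl2020, §3.1 ("`M ⪰ 0`")] [cite: DolanOsborn2004, §3 eq. (3.11)] -/
theorem dom1TermForm_nonneg_of_test (F : ScanFunctional) (D : Dims) {κ Δ : ℝ} {ℓ n j : ℕ}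
    (hA : 0 ≤ domX1Term F D κ (Δ + (n : ℝ)) j) (hC : 0 ≤ domY1Term F D κ (Δ + (n : ℝ)) j)
    (hB : w1Form1A F D (zMono (Δ + (n : ℝ)) j) ^ 2 ≤
      4 * domX1Term F D κ (Δ + (n : ℝ)) j * domY1Term F D κ (Δ + (n : ℝ)) j)
    (x y : ℝ) : 0 ≤ dom1TermForm F D κ Δ ℓ n j x y := by
  have hA' : 0 ≤ rhoS1 D Δ ℓ n j ^ 2 * domX1Term F D κ (Δ + (n : ℝ)) j := mul_nonneg (sq_nonneg _) hA
  have hC' : 0 ≤ rhoT1 D Δ ℓ n j ^ 2 * domY1Term F D κ (Δ + (n : ℝ)) j := mul_nonneg (sq_nonneg _) hC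
  have hρ : 0 ≤ rhoS1 D Δ ℓ n j ^ 2 * rhoT1 D Δ ℓ n j ^ 2 := mul_nonneg (sq_nonneg _) (sq_nonneg _)
  have hB' : (rhoS1 D Δ ℓ n j * rhoT1 D Δ ℓ n j * w1Form1A F D (zMono (Δ + (n : ℝ)) j)) ^ 2 ≤
      4 * (rhoS1 D Δ ℓ n j ^ 2 * domX1Term F D κ (Δ + (n : ℝ)) j) *
        (rhoT1 D Δ ℓ n j ^ 2 * domY1Term F D κ (Δ + (n : ℝ)) j) := by
    have h := mul_le_mul_of_nonneg_left hB hρ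
    calc (rhoS1 D Δ ℓ n j * rhoT1 D Δ ℓ n j * w1Form1A F D (zMono (Δ + (n : ℝ)) j)) ^ 2
        = rhoS1 D Δ ℓ n j ^ 2 * rhoT1 D Δ ℓ n j ^ 2 * w1Form1A F D (zMono (Δ + (n : ℝ)) j) ^ 2 := by
          ring
      _ ≤ rhoS1 D Δ ℓ n j ^ 2 * rhoT1 D Δ ℓ n j ^ 2 *
            (4 * domX1Term F D κ (Δ + (n : ℝ)) j * domY1Term F D κ (Δ + (n : ℝ)) j) := h
      _ = _ := by ring
  have h := binForm_nonneg hA' hC' hB' x y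
  unfold dom1TermForm
  linarith

/-- **Pairs series of `𝔇₁ʸ[g^{−d,d}]`** at a regular point: coefficients `A_{n,j}(d/2, d/2)/λ_ℓ`.
[cite: DolanOsborn2004, §3 eq. (3.10)] [cite: KosPolandSimmonsduffin2014, §3.3 eq. (3.16)] -/
theorem hasSum_domY1Eval (F : ScanFunctional) (D : Dims) (κ : ℝ) {Δ : ℝ} {ℓ : ℕ} {G₂ : ℝ → ℝ → ℝ}
    (hΔ : unitarityBound3D ℓ < Δ) (hreg : ¬ accidentalDegeneracy3D Δ ℓ)
    (hG₂ : IsConformalBlock3D (-(D.Δt - D.Δφ)) (D.Δt - D.Δφ) Δ ℓ G₂) :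
    HasSum (fun q : ℕ × ℕ => hrCoeffAB ((D.Δt - D.Δφ) / 2) ((D.Δt - D.Δφ) / 2) Δ ℓ q.1 q.2 /
        legendreLam ℓ * domY1Term F D κ (Δ + (q.1 : ℝ)) q.2) (domY1Eval F D κ G₂) := by
  have ha := hasSum_pointFunctional_crossF_hrZAB (fun m => 2 * F.w m 9) F.z F.zb F.hz F.hzb
    (D.expo .φttφ) (-1) hΔ hreg rfl hG₂
  have hb := hasSum_pointFunctional_crossF_hrZAB
    (fun m => 2 * F.w m 11 - 2 * (|F.w m 6| + |F.w m 7|) - κ⁻¹ * bWeight1 F m)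
    F.z F.zb F.hz F.hzb (D.expo .φttφ) 1 hΔ hreg rfl hG₂
  rw [domY1Eval_eq_pointFunctional_add]
  refine (ha.add hb).congr_fun fun q => ?_
  rw [domY1Term, domY1Eval_eq_pointFunctional_add]
  ring

/-- **Pairs series of `𝔇₁ˣ[g^{−dₛ,dₛ}]`** at a regular point: coefficients `A_{n,j}(dₛ/2, dₛ/2)/λ_ℓ`.
[cite: DolanOsborn2004, §3 eq. (3.10)] [cite: KosPolandSimmonsduffin2014, §3.3 eq. (3.16)] -/
theorem hasSum_domX1Eval (F : ScanFunctional) (D : Dims) (κ : ℝ) {Δ : ℝ} {ℓ : ℕ} {G₂ : ℝ → ℝ → ℝ}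
    (hΔ : unitarityBound3D ℓ < Δ) (hreg : ¬ accidentalDegeneracy3D Δ ℓ)
    (hG₂ : IsConformalBlock3D (-(D.Δφ - D.Δs)) (D.Δφ - D.Δs) Δ ℓ G₂) :
    HasSum (fun q : ℕ × ℕ => hrCoeffAB ((D.Δφ - D.Δs) / 2) ((D.Δφ - D.Δs) / 2) Δ ℓ q.1 q.2 /
        legendreLam ℓ * domX1Term F D κ (Δ + (q.1 : ℝ)) q.2) (domX1Eval F D κ G₂) := by
  have ha := hasSum_pointFunctional_crossF_hrZAB (fun m => 2 * F.w m 17) F.z F.zb F.hz F.hzb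
    (D.expo .sφφs) (-1) hΔ hreg rfl hG₂
  have hb := hasSum_pointFunctional_crossF_hrZAB
    (fun m => -(2 * F.w m 18) - 2 * |F.w m 13| - κ * bWeight1 F m)
    F.z F.zb F.hz F.hzb (D.expo .sφφs) 1 hΔ hreg rfl hG₂
  rw [domX1Eval_eq_pointFunctional_add]
  refine (ha.add hb).congr_fun fun q => ?_
  rw [domX1Term, domX1Eval_eq_pointFunctional_add]
  ring

/-- **Pairs series of `W¹[g^{dₛ,−d}]` through the ALIGNED kernel** strictly above the bound (`Δ ≠ 1` if
`ℓ = 0`): `W¹[G_{φsφt}] = Σ_{(n,j)} (A_{n,j}(dₛ/2, d/2)/λ_ℓ) W¹♮[𝒫_{Δ+n,j}]` — the general-ordering series of the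
conjugated block `g^{−dₛ,d}`. [cite: DolanOsborn2004, §3 eqs. (3.10)–(3.11)] [cite: DolanOsborn2011, §2 eqs. (2.43)–(2.44)]
[cite: KosPolandSimmonsduffin2014, §3.3 eq. (3.16)] -/
theorem hasSum_w1Form1 (F : ScanFunctional) (D : Dims) {Δ : ℝ} {ℓ : ℕ} {H : ℝ → ℝ → ℝ}
    (hΔ : unitarityBound3D ℓ < Δ) (h1 : ℓ = 0 → Δ ≠ 1)
    (hH : IsConformalBlock3D (D.Δφ - D.Δs) (-(D.Δt - D.Δφ)) Δ ℓ H) :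
    HasSum (fun q : ℕ × ℕ => hrCoeffAB ((D.Δφ - D.Δs) / 2) ((D.Δt - D.Δφ) / 2) Δ ℓ q.1 q.2 /
        legendreLam ℓ * w1Form1A F D (zMono (Δ + (q.1 : ℝ)) q.2)) (w1Form1 F D H) := by
  have P := hasSum_pointFunctional_crossF_hrZAB_general (fun m => F.w m 19) F.z F.zb F.hz F.hzb
    (D.expo .φsφt - (-(D.Δt - D.Δφ) - (D.Δφ - D.Δs)) / 2) (-1) hΔ h1 (conj_φsφt hH)
  rw [neg_neg] at P
  rw [w1Form1_eq_w1Form1A]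
  refine (P.mul_left 2).congr_fun fun q => ?_
  simp only [w1Form1A, nodeEval]
  ring

/-- **The rank-one rewriting of the three coefficient families** at level `(n,j)` (strictly above the bound,
`Δ ≠ 1` if `ℓ = 0`): `A(d/2,d/2) = A(0,0)ρₜ²`, `A(dₛ/2,dₛ/2) = A(0,0)ρₛ²`, `A(dₛ/2,d/2) = A(0,0)ρₛρₜ`.
[cite: DolanOsborn2004, §3 eq. (3.11)] -/
theorem coeffs1_eq (D : Dims) {Δ : ℝ} {ℓ : ℕ} (hΔ : unitarityBound3D ℓ < Δ) (h1 : ℓ = 0 → Δ ≠ 1)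
    (n j : ℕ) :
    hrCoeffAB ((D.Δt - D.Δφ) / 2) ((D.Δt - D.Δφ) / 2) Δ ℓ n j = hrCoeff Δ ℓ n j * rhoT1 D Δ ℓ n j ^ 2 ∧
      hrCoeffAB ((D.Δφ - D.Δs) / 2) ((D.Δφ - D.Δs) / 2) Δ ℓ n j = hrCoeff Δ ℓ n j * rhoS1 D Δ ℓ n j ^ 2 ∧
      hrCoeffAB ((D.Δφ - D.Δs) / 2) ((D.Δt - D.Δφ) / 2) Δ ℓ n j =
        hrCoeff Δ ℓ n j * (rhoS1 D Δ ℓ n j * rhoT1 D Δ ℓ n j) := by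
  have hP := (doPochFactor_zero_zero_pos hΔ h1 n j).ne'
  refine ⟨?_, ?_, ?_⟩
  · rw [hrCoeffAB_eq_hrCoeff_mul_doPochRatio hP, rhoT1, sq, mul_assoc]
  · rw [hrCoeffAB_eq_hrCoeff_mul_doPochRatio hP, rhoS1, sq, mul_assoc]
  · rw [hrCoeffAB_eq_hrCoeff_mul_doPochRatio hP, rhoS1, rhoT1, mul_assoc]

/-- **Pairs series of the dominated charge-`1` form**: `𝔇₁(x,y) = Σ_{(n,j)} (A_{n,j}(0,0)/λ_ℓ) 𝔗_{n,j}(x,y)`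
at a regular point above the bound (`Δ ≠ 1` if `ℓ = 0`). [cite: DolanOsborn2004, §3 eqs. (3.10)–(3.11)]
[cite: HogervorstRychkov2013, §3 eqs. (3.6), (3.9)] [cite: KosPolandSimmonsduffin2014, §3.3 eq. (3.16)] -/
theorem hasSum_dom1Form (F : ScanFunctional) (D : Dims) (κ : ℝ) {Δ : ℝ} {ℓ : ℕ}
    {G : Label → ℝ → ℝ → ℝ} (hΔ : unitarityBound3D ℓ < Δ) (hreg : ¬ accidentalDegeneracy3D Δ ℓ)
    (h1 : ℓ = 0 → Δ ≠ 1) (hG₂ : IsConformalBlock3D (-(D.Δt - D.Δφ)) (D.Δt - D.Δφ) Δ ℓ (G .φttφ))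
    (hG₄ : IsConformalBlock3D (-(D.Δφ - D.Δs)) (D.Δφ - D.Δs) Δ ℓ (G .sφφs))
    (hG₅ : IsConformalBlock3D (D.Δφ - D.Δs) (-(D.Δt - D.Δφ)) Δ ℓ (G .φsφt)) (x y : ℝ) :
    HasSum (fun q : ℕ × ℕ => hrCoeff Δ ℓ q.1 q.2 / legendreLam ℓ * dom1TermForm F D κ Δ ℓ q.1 q.2 x y)
      (dom1Form F D κ G x y) := by
  have hX := hasSum_domX1Eval F D κ hΔ hreg hG₄
  have hY := hasSum_domY1Eval F D κ hΔ hreg hG₂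
  have hW1 := hasSum_w1Form1 F D hΔ h1 hG₅
  have hsum := ((hX.mul_left (x ^ 2)).add (hY.mul_left (y ^ 2))).add (hW1.mul_left (x * y))
  rw [dom1Form]
  refine hsum.congr_fun fun q => ?_
  obtain ⟨e₁, e₂, e₃⟩ := coeffs1_eq D hΔ h1 q.1 q.2
  simp only [dom1TermForm]
  rw [e₁, e₂, e₃]
  ring

/-- **`𝔇₁(x,y) ≥ 0` from a finite head + non-negative tail term forms** (regular point above the bound,
`Δ ≠ 1` if `ℓ = 0`). [cite: HogervorstRychkov2013, §3 eqs. (3.6), (3.9)] [cite: KosPolandSimmonsduffin2014, §3.3 eq. (3.16)]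
[cite: DolanOsborn2004, §3 eq. (3.11)] -/
theorem dom1Form_nonneg_of_termwise (F : ScanFunctional) (D : Dims) (κ : ℝ) {Δ : ℝ} {ℓ : ℕ}
    (hΔ : unitarityBound3D ℓ < Δ) (hreg : ¬ accidentalDegeneracy3D Δ ℓ) (h1 : ℓ = 0 → Δ ≠ 1)
    (S : Finset (ℕ × ℕ))
    (hhead : ∀ x y : ℝ, 0 ≤ ∑ q ∈ S, hrCoeff Δ ℓ q.1 q.2 / legendreLam ℓ * dom1TermForm F D κ Δ ℓ q.1 q.2 x y)
    (htail : ∀ q : ℕ × ℕ, q ∉ S → InDescendantRange ℓ q.1 q.2 →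
      ∀ x y : ℝ, 0 ≤ dom1TermForm F D κ Δ ℓ q.1 q.2 x y)
    {G : Label → ℝ → ℝ → ℝ} (hG₂ : IsConformalBlock3D (-(D.Δt - D.Δφ)) (D.Δt - D.Δφ) Δ ℓ (G .φttφ))
    (hG₄ : IsConformalBlock3D (-(D.Δφ - D.Δs)) (D.Δφ - D.Δs) Δ ℓ (G .sφφs))
    (hG₅ : IsConformalBlock3D (D.Δφ - D.Δs) (-(D.Δt - D.Δφ)) Δ ℓ (G .φsφt)) (x y : ℝ) :
    0 ≤ dom1Form F D κ G x y := by
  have hS := hasSum_dom1Form F D κ hΔ hreg h1 hG₂ hG₄ hG₅ x y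
  refine (hhead x y).trans (sum_le_hasSum S (fun q hq => ?_) hS)
  by_cases hr : InDescendantRange ℓ q.1 q.2
  · exact mul_nonneg (div_nonneg (hrCoeff_nonneg hΔ _ _) (legendreLam_pos ℓ).le) (htail q hq hr x y)
  · rw [hrCoeff_eq_zero_of_not_inDescendantRange Δ hr, zero_div, zero_mul]

/-- `Pos1` of a scan functional from nonnegativity of the charge-`1` sector form (`ε = (−1)^ℓ`) on genuine
`z`-coordinate blocks. [cite: ChesterEtAl2020, §3.1 ("`M ⪰ 0`")] [cite: KosPolandSimmonsduffin2014, §3.3 eq. (3.16)] -/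
theorem pos1_of_forall_sector1Form_nonneg (F : ScanFunctional) (D : Dims) {Δ : ℝ} {ℓ : ℕ}
    (h : ∀ G : Label → ℝ → ℝ → ℝ, (∀ L ∈ labels1, IsConformalBlock3D (d12 D L) (d34 D L) Δ ℓ (G L)) →
      ∀ x y : ℝ, 0 ≤ sector1Form F D ((-1) ^ ℓ) G x y) :
    Pos1 F.toFunctional D Δ ℓ := by
  intro g hg
  refine PosSemidef.of_dotProduct_mulVec_nonneg (isHermitian_alphaMat _ (V1_transpose D _ g)) fun v => ?_
  have hv : v = ![v 0, v 1] := by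
    funext i; fin_cases i <;> rfl
  rw [star_trivial, hv, sector1Form_eq]
  exact h _ (blocks_of_genuineOn_labels1 hg) _ _

/-- **Sector `1` at a regular `(Δ, ℓ)` from termwise domination**: for some `κ > 0`, a finite head
`Σ_{q ∈ S} (A_q(0,0)/λ_ℓ) 𝔗_q(x,y) ≥ 0` for all `(x, y)` and every tail term form `≥ 0` for all `(x, y)`
(e.g. by the `ρ`-free test `dom1TermForm_nonneg_of_test`) give `α(V⃗_{1,Δ,ℓ}) ⪰ 0` (`ε = (−1)^ℓ`).
[cite: PappadopuloRychkovEspinRattazzi2012, §5] [cite: KosPolandSimmonsduffin2014, §3.3 eq. (3.16)]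
[cite: ChesterEtAl2020, §3.1 (functional conditions)] [cite: DolanOsborn2004, §3 eq. (3.11)] -/
theorem pos1_of_dom_termwise (F : ScanFunctional) (D : Dims) {κ : ℝ} (hκ : 0 < κ) {Δ : ℝ} {ℓ : ℕ}
    (hΔ : unitarityBound3D ℓ < Δ) (hreg : ¬ accidentalDegeneracy3D Δ ℓ) (h1 : ℓ = 0 → Δ ≠ 1)
    (S : Finset (ℕ × ℕ))
    (hhead : ∀ x y : ℝ, 0 ≤ ∑ q ∈ S, hrCoeff Δ ℓ q.1 q.2 / legendreLam ℓ *
      dom1TermForm F D κ Δ ℓ q.1 q.2 x y)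
    (htail : ∀ q : ℕ × ℕ, q ∉ S → InDescendantRange ℓ q.1 q.2 →
      ∀ x y : ℝ, 0 ≤ dom1TermForm F D κ Δ ℓ q.1 q.2 x y) :
    Pos1 F.toFunctional D Δ ℓ :=
  pos1_of_forall_sector1Form_nonneg F D fun _ hG x y => by
    obtain ⟨h₁, h₂, h₃, h₄, h₅, h₆⟩ := blocks1_of_forall hG
    exact (dom1Form_nonneg_of_termwise F D κ hΔ hreg h1 S hhead htail h₂ h₄ h₅ x y).trans
      (dom1Form_le_sector1Form F D (abs_neg_one_pow_le_one ℓ) hκ hΔ hreg h1 h₁ h₂ h₃ h₄ h₆ x y)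

/-- **Fully termwise form, sector `1`.** [cite: PappadopuloRychkovEspinRattazzi2012, §5]
[cite: ChesterEtAl2020, §3.1 (functional conditions)] [cite: DolanOsborn2004, §3 eq. (3.11)] -/
theorem pos1_of_dom_forall (F : ScanFunctional) (D : Dims) {κ : ℝ} (hκ : 0 < κ) {Δ : ℝ} {ℓ : ℕ}
    (hΔ : unitarityBound3D ℓ < Δ) (hreg : ¬ accidentalDegeneracy3D Δ ℓ) (h1 : ℓ = 0 → Δ ≠ 1)
    (hterm : ∀ q : ℕ × ℕ, InDescendantRange ℓ q.1 q.2 →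
      ∀ x y : ℝ, 0 ≤ dom1TermForm F D κ Δ ℓ q.1 q.2 x y) :
    Pos1 F.toFunctional D Δ ℓ :=
  pos1_of_dom_termwise F D hκ hΔ hreg h1 ∅ (by simp) (fun q _ hr => hterm q hr)

/-! ### §4 Non-regular points by right limits -/

/-- The charge-`1` sector form is continuous along pointwise convergence of the six blocks on the open square.
Elementary (finitely many node values). [cite: KosPolandSimmonsduffin2014, §4 eqs. (4.2)–(4.3)] -/
theorem tendsto_sector1Form (F : ScanFunctional) (D : Dims) (ε : ℝ) (Gf : ℝ → Label → ℝ → ℝ → ℝ)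
    (G : Label → ℝ → ℝ → ℝ) (l : Filter ℝ)
    (hG : ∀ L ∈ labels1, ∀ x y : ℝ, x ∈ Ioo (0 : ℝ) 1 → y ∈ Ioo (0 : ℝ) 1 →
      Tendsto (fun Δ' => Gf Δ' L x y) l (𝓝 (G L x y))) (x y : ℝ) :
    Tendsto (fun Δ' => sector1Form F D ε (Gf Δ') x y) l (𝓝 (sector1Form F D ε G x y)) := by
  have T := fun (r : Fin 22) (s sgn : ℝ) {L : Label} (hL : L ∈ labels1) =>
    tendsto_pointFunctional_crossF (fun m => F.w m r) F.z F.zb F.hz F.hzb s sgn (fun Δ' => Gf Δ' L) (G L) l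
      (hG L hL)
  have h₁ : Label.tφtφ ∈ labels1 := by simp [labels1]
  have h₂ : Label.φttφ ∈ labels1 := by simp [labels1]
  have h₃ : Label.φsφs ∈ labels1 := by simp [labels1]
  have h₄ : Label.sφφs ∈ labels1 := by simp [labels1]
  have h₅ : Label.φsφt ∈ labels1 := by simp [labels1]
  have h₆ : Label.sφφt ∈ labels1 := by simp [labels1]
  simp only [sector1Form, xForm1, yForm1, wForm1, w1Form1, w2Form1, nodeEval]
  exact ((((((T 13 (D.expo .φsφs) (-1) h₃).const_mul (2 * ε)).add
        ((T 17 (D.expo .sφφs) (-1) h₄).const_mul 2)).sub ((T 18 (D.expo .sφφs) 1 h₄).const_mul 2)).const_mul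
        (x ^ 2)).add
      ((((((T 6 (D.expo .tφtφ) (-1) h₁).const_mul (2 * ε)).add ((T 7 (D.expo .tφtφ) 1 h₁).const_mul (2 * ε))).add
        ((T 9 (D.expo .φttφ) (-1) h₂).const_mul 2)).add ((T 11 (D.expo .φttφ) 1 h₂).const_mul 2)).const_mul
        (y ^ 2))).add
    ((((T 19 (D.expo .φsφt) (-1) h₅).const_mul 2).add
      ((((T 20 (D.expo .sφφt) (-1) h₆).const_mul 2).add ((T 21 (D.expo .sφφt) 1 h₆).const_mul 2)).const_mul
        ε)).const_mul (x * y))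

/-- **Sector `1` at a NON-REGULAR point from the right**: if `(Δ, ℓ)` is not regular and, for all `Δ'` in a
right neighbourhood, `(Δ', ℓ)` is regular and the charge-`1` sector form (`ε = (−1)^ℓ`) is `≥ 0` on genuine
blocks at `(Δ', ℓ)` for every `(x, y)`, then `Pos1` at `(Δ, ℓ)`. [cite: KosPolandSimmonsduffin2014, §4 eqs. (4.2)–(4.3)]
[cite: ChesterEtAl2020, §3.1 (functional conditions)] -/
theorem pos1_of_eventually_right (F : ScanFunctional) (D : Dims) {Δ : ℝ} {ℓ : ℕ}
    (hΔ : ¬ IsRegularPoint3D Δ ℓ)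
    (h : ∀ᶠ Δ' in 𝓝[>] Δ, IsRegularPoint3D Δ' ℓ ∧ ∀ G : Label → ℝ → ℝ → ℝ,
      (∀ L ∈ labels1, IsConformalBlock3D (d12 D L) (d34 D L) Δ' ℓ (G L)) →
      ∀ x y : ℝ, 0 ≤ sector1Form F D ((-1) ^ ℓ) G x y) :
    Pos1 F.toFunctional D Δ ℓ := by
  refine pos1_of_forall_sector1Form_nonneg F D fun G hG x y => ?_
  obtain ⟨Gf, hGa, hGl⟩ := exists_approximants_of_not_isRegularPoint3D' hΔ labels1 (d12 D) (d34 D) hG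
  have hlim := tendsto_sector1Form F D ((-1) ^ ℓ) Gf G (𝓝[>] Δ) hGl x y
  refine ge_of_tendsto hlim ?_
  have hIoo : Ioo Δ (Δ + 1) ∈ 𝓝[>] Δ := Ioo_mem_nhdsGT (by linarith)
  filter_upwards [h, hIoo] with Δ' hΔ' hmem
  exact hΔ'.2 (Gf Δ') (fun L hL => Or.inl ⟨hΔ'.1, hGa L hL Δ' hmem⟩) x y

/-- **The regular-point estimate packaged for the right-limit rule** (`|ε| ≤ 1`, `κ > 0`).
[cite: PappadopuloRychkovEspinRattazzi2012, §5] [cite: DolanOsborn2004, §3 eq. (3.11)] -/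
theorem sector1Form_nonneg_of_dom_termwise (F : ScanFunctional) (D : Dims) {ε κ : ℝ} (hε : |ε| ≤ 1)
    (hκ : 0 < κ) {Δ : ℝ} {ℓ : ℕ} (hΔ : unitarityBound3D ℓ < Δ) (hreg : ¬ accidentalDegeneracy3D Δ ℓ)
    (h1 : ℓ = 0 → Δ ≠ 1) (S : Finset (ℕ × ℕ))
    (hhead : ∀ x y : ℝ, 0 ≤ ∑ q ∈ S, hrCoeff Δ ℓ q.1 q.2 / legendreLam ℓ * dom1TermForm F D κ Δ ℓ q.1 q.2 x y)
    (htail : ∀ q : ℕ × ℕ, q ∉ S → InDescendantRange ℓ q.1 q.2 →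
      ∀ x y : ℝ, 0 ≤ dom1TermForm F D κ Δ ℓ q.1 q.2 x y)
    {G : Label → ℝ → ℝ → ℝ} (hG : ∀ L ∈ labels1, IsConformalBlock3D (d12 D L) (d34 D L) Δ ℓ (G L))
    (x y : ℝ) : 0 ≤ sector1Form F D ε G x y := by
  obtain ⟨h₁', h₂, h₃, h₄, h₅, h₆⟩ := blocks1_of_forall hG
  exact (dom1Form_nonneg_of_termwise F D κ hΔ hreg h1 S hhead htail h₂ h₄ h₅ x y).trans
    (dom1Form_le_sector1Form F D hε hκ hΔ hreg h1 h₁' h₂ h₃ h₄ h₆ x y)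

end Literature.MathematicalPhysics.QuantumFieldTheory.O2ChargeOneTermwise
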